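import Mathlib.Combinatorics.SimpleGraph.DegreeSum
import Mathlib.Data.Fintype.Pigeonhole
import Mathlib.Data.Fintype.Vector
import Literature.Computability.Complexity.TFNPProblems
import HarnessLib

/-!
# The canonical total search problems IV: LEAF and PIGEON (the parity argument and the
# pigeonhole principle), and the classes `PPA`, `PPP`

Continuation of `TFNPProblems.lean` (conventions there: circuits as lists of programs of
`CircEval.evalFn` — `TFNP.evalBits`; vertices `{0,1}ⁿ` with `0ⁿ = TFNP.zero n`; codes
`TFNP.instCode n Cs`; problems `TFNP.ofCircuits V Sol`) and `TFNPClasses.lean` (`PPAD`, `PLS`,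
`EOPL` as `TFNP.closureOf` of their presenting problems).  Papadimitriou's two other "inefficient
proofs of existence":

* `TFNP.Leaf` — the presenting problem of `PPA`: two circuits `N₁, N₂ : {0,1}ⁿ → {0,1}ⁿ` propose
  at most two neighbours of each vertex, edges are the MUTUAL proposals ("symmetry is guaranteed
  syntactically"), `0ⁿ` is a leaf; find another leaf (Papadimitriou 1994, §2 — specialised from
  pairing machines on a configuration space `Σ^{≤ p(|x|)}` to circuits on `{0,1}ⁿ`, as in all
  circuit problems of these files); PROVED total (`Leaf.isTotal`, the parity argument: Mathlib's
  handshake lemma `SimpleGraph.exists_ne_odd_degree_of_exists_odd_degree` on the graph of mutual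
  proposals).
* `TFNP.Pigeon` — PIGEONHOLE CIRCUIT, the complete problem of `PPP`: a circuit
  `C : {0,1}ⁿ → {0,1}ⁿ`; find `x` with `C(x) = 0ⁿ`, or `x ≠ x'` with `C(x) = C(x')`
  (Papadimitriou 1994, §5); PROVED total (`Pigeon.isTotal`, the pigeonhole principle via
  `Fintype.exists_ne_map_eq_of_card_lt` on `List.Vector Bool n`).
* `PPA := TFNP.closureOf TFNP.Leaf` ("PPA is the closure under reductions of the class of search
  problems defined so far", Papadimitriou 1994, §2) and `PPP := TFNP.closureOf TFNP.Pigeon`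
  (loc. cit. §5), with the one-line API (inside `TFNP`, closed downwards under `≤ₘ`, solvable in
  `FP` under `NP ⊆ P`) — the vocabulary in which route `PneNP/DirichletPigeons` states
  "DIRICHLET `∈ PPP`".

| problem | data `Cs` | valid | solutions | source |
|---|---|---|---|---|
| `Leaf` | `[N₁, N₂]` | `deg 0ⁿ = 1` | another leaf: `x ≠ 0ⁿ`, `|x| = n`, `deg x = 1` | Pap94 §2 |
| `Pigeon` | `[C]` | — | `⟨x, x'⟩`: `C x = 0ⁿ`, or `x ≠ x'`, `C x = C x'` | Pap94 §5 |

NOT here: `Leaf ∈ PPA`, `Pigeon ∈ PPP` (missing: `rel ∈ P`, `valid ∈ P` for the presenting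
problems — the stack-program exercise with `CircEval.evalFn_mem_FP` left open in
`TFNPProblems.lean`), Papadimitriou's inclusions `PPAD ⊆ PPA` (§2, Prop. 1 ff.) and `PPAD ⊆ PPP`
(§5), and the classes `PPADS`, `PPA-q`.

## References

* C. H. Papadimitriou, *On the complexity of the parity argument and other inefficient proofs of
  existence*, JCSS 48 (1994): §2, pp. 504–506 (the parity argument, PPA, "any leaf other than the
  standard one"), §5, pp. 528–529 (PPP, PIGEONHOLE CIRCUIT: "either find an input x such that
  C(x) = 0ⁿ or two inputs x ≠ x' such that C(x) = C(x')"). [Papadimitriou1994Parity]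
* N. Megiddo, C. H. Papadimitriou, *On total functions, existence theorems and computational
  complexity*, TCS 81 (1991), p. 318 and Thm. 2.1 (`FNP ⊆ FP`-type collapses under `P = NP`).
  [MegiddoPapadimitriou1991]
-/

namespace Literature.Computability.Complexity

open _root_.Computability

namespace TFNP

/-! ### LEAF (the parity argument) -/

/-- The candidate neighbours of `c` proposed by the two circuits: `{N₁(c), N₂(c)} ∖ {c}` as a
duplicate-free list (a circuit answering `c` itself proposes no neighbour — Papadimitriou's "set of
at most two configurations"). [Papadimitriou 1994, §2 (M(x, c))] [cite: Papadimitriou1994Parity, §2] -/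
def Leaf.nbrs (N₁ N₂ : List (List Bool)) (c : List Bool) : List (List Bool) :=
  ([evalBits N₁ c, evalBits N₂ c].filter fun c' => decide (c' ≠ c)).dedup

/-- The degree of `c` in the symmetric graph `[c, c'] ∈ G ⟺ c' ∈ nbrs c ∧ c ∈ nbrs c'` ("symmetry
is guaranteed syntactically"). [Papadimitriou 1994, §2] [cite: Papadimitriou1994Parity, §2] -/
def Leaf.deg (N₁ N₂ : List (List Bool)) (c : List Bool) : ℕ :=
  ((Leaf.nbrs N₁ N₂ c).filter fun c' => decide (c ∈ Leaf.nbrs N₁ N₂ c')).length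

/-- Side condition of LEAF on `(n, [N₁, N₂])`: neighbour circuits with `n` outputs and `0ⁿ` is a
leaf (degree `1`; "M is such that … 0…0 is always a leaf (the standard leaf)").
[Papadimitriou 1994, §2] [cite: Papadimitriou1994Parity, §2] -/
def Leaf.IsValid (n : ℕ) : List (List (List Bool)) → Prop
  | [N₁, N₂] => N₁.length = n ∧ N₂.length = n ∧ Leaf.deg N₁ N₂ (zero n) = 1
  | _ => False

/-- Solutions of LEAF: a leaf other than `0ⁿ` (in a graph of degree `≤ 2`, the odd-degree vertices).
[Papadimitriou 1994, §2 ("Given x, find a leaf of G(x) other than 0…0")]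
[cite: Papadimitriou1994Parity, §2] -/
def Leaf.IsSolution (n : ℕ) : List (List (List Bool)) → List Bool → Prop
  | [N₁, N₂], x => x.length = n ∧ x ≠ zero n ∧ Leaf.deg N₁ N₂ x = 1
  | _, _ => False

/-- **LEAF.** Given circuits `N₁, N₂ : {0,1}ⁿ → {0,1}ⁿ` proposing at most two neighbours of each
vertex, with edges the mutual proposals and `0ⁿ` a leaf, find another leaf. The presenting problem
of `PPA` (Papadimitriou's definition of PPA by neighbourhood machines, specialised to the
configuration space `{0,1}ⁿ` and circuits). [Papadimitriou 1994, §2 (PPA)]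
[cite: Papadimitriou1994Parity, §2] -/
def Leaf : SearchProblem :=
  ofCircuits Leaf.IsValid Leaf.IsSolution

/-- LEAF is polynomially balanced. [folklore] -/
theorem Leaf.isPolyBalanced : Leaf.IsPolyBalanced := by
  refine ofCircuits_isPolyBalanced 1 fun n Cs x h => ?_
  match Cs, h with
  | [N₁, N₂], h => simp only [Leaf.IsSolution] at h; omega

/-- Proposed neighbours are outputs of `N₁` or `N₂`. [folklore] -/
theorem Leaf.mem_nbrs {N₁ N₂ : List (List Bool)} {c c' : List Bool} (h : c' ∈ Leaf.nbrs N₁ N₂ c) :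
    (c' = evalBits N₁ c ∨ c' = evalBits N₂ c) ∧ c' ≠ c := by
  simpa [Leaf.nbrs, List.mem_dedup, List.mem_filter] using h

/-- No vertex proposes itself. [folklore] -/
theorem Leaf.not_mem_nbrs_self (N₁ N₂ : List (List Bool)) (c : List Bool) : c ∉ Leaf.nbrs N₁ N₂ c :=
  fun h => (Leaf.mem_nbrs h).2 rfl

/-- Degrees are at most `2`. [Papadimitriou 1994, §2 ("a symmetric graph of degree at most two")]
[cite: Papadimitriou1994Parity, §2] -/
theorem Leaf.deg_le_two (N₁ N₂ : List (List Bool)) (c : List Bool) : Leaf.deg N₁ N₂ c ≤ 2 :=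
  calc Leaf.deg N₁ N₂ c ≤ (Leaf.nbrs N₁ N₂ c).length := (List.filter_sublist.length_le)
    _ ≤ ([evalBits N₁ c, evalBits N₂ c].filter fun c' => decide (c' ≠ c)).length :=
      (List.dedup_sublist _).length_le
    _ ≤ 2 := (List.filter_sublist.length_le)

/-- **LEAF is total** — the parity argument: in the finite symmetric graph of mutual proposals on
`{0,1}ⁿ` (a `SimpleGraph` on `List.Vector Bool n` whose degrees are the `Leaf.deg`), the leaf `0ⁿ`
has odd degree, so by the handshake lemma (`SimpleGraph.exists_ne_odd_degree_of_exists_odd_degree`)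
some other vertex has odd degree, i.e. degree `1` since degrees are `≤ 2`. [Papadimitriou 1994,
§1 ("the parity argument: any finite graph has an even number of odd-degree nodes") and §2]
[cite: Papadimitriou1994Parity, §2] -/
theorem Leaf.isTotal : Leaf.IsTotal := by
  classical
  refine ofCircuits_isTotal_iff.2 fun n Cs hV => ?_
  match Cs, hV with
  | [N₁, N₂], hV =>
    obtain ⟨h1, h2, hdeg0⟩ := hV
    simp only [Leaf.IsSolution]
    -- proposed neighbours are vertices
    have hlen : ∀ c c' : List Bool, c' ∈ Leaf.nbrs N₁ N₂ c → c'.length = n := fun c c' hc' => by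
      rcases (Leaf.mem_nbrs hc').1 with rfl | rfl
      · rw [length_evalBits, h1]
      · rw [length_evalBits, h2]
    -- the graph of mutual proposals on `{0,1}ⁿ`
    let G : SimpleGraph (List.Vector Bool n) :=
      { Adj := fun v w => w.1 ∈ Leaf.nbrs N₁ N₂ v.1 ∧ v.1 ∈ Leaf.nbrs N₁ N₂ w.1
        symm := ⟨fun v w h => ⟨h.2, h.1⟩⟩
        loopless := ⟨fun v h => Leaf.not_mem_nbrs_self N₁ N₂ v.1 h.1⟩ }
    have hGdeg : ∀ v : List.Vector Bool n, G.degree v = Leaf.deg N₁ N₂ v.1 := fun v => by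
      set L := (Leaf.nbrs N₁ N₂ v.1).filter fun c' => decide (v.1 ∈ Leaf.nbrs N₁ N₂ c') with hL
      have hLn : L.Nodup := (List.nodup_dedup _).filter _
      let Lv : List (List.Vector Bool n) :=
        L.pmap (fun c' (h : c'.length = n) => ⟨c', h⟩) fun c' hc' => hlen _ _ (List.mem_filter.1 hc').1
      have hmem : ∀ w : List.Vector Bool n, w ∈ Lv ↔ G.Adj v w := fun w => by
        simp only [Lv, List.mem_pmap, hL, List.mem_filter, decide_eq_true_eq]
        constructor
        · rintro ⟨c', ⟨hc1, hc2⟩, rfl⟩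
          exact ⟨hc1, hc2⟩
        · rintro ⟨hw1, hw2⟩
          exact ⟨w.1, ⟨hw1, hw2⟩, rfl⟩
      have hfin : G.neighborFinset v = Lv.toFinset := by
        ext w
        rw [SimpleGraph.mem_neighborFinset, List.mem_toFinset, hmem]
      have hLvn : Lv.Nodup := hLn.pmap fun a _ b _ h => congrArg Subtype.val h
      rw [← SimpleGraph.card_neighborFinset_eq_degree, hfin, List.toFinset_card_of_nodup hLvn,
        List.length_pmap]
      rfl
    let z : List.Vector Bool n := ⟨zero n, length_zero n⟩
    have hodd : Odd (G.degree z) := by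
      rw [hGdeg]
      exact ⟨0, hdeg0⟩
    obtain ⟨w, hwz, hw⟩ := G.exists_ne_odd_degree_of_exists_odd_degree z hodd
    rw [hGdeg] at hw
    refine ⟨w.1, w.2, fun h => hwz (Subtype.ext h), ?_⟩
    have hle := Leaf.deg_le_two N₁ N₂ w.1
    obtain ⟨k, hk⟩ := hw
    omega

/-! ### PIGEON (the pigeonhole principle) -/

/-- Well-formedness of PIGEONHOLE CIRCUIT on `(n, [C])`: `C` has `n` outputs. [Papadimitriou 1994,
§5] [cite: Papadimitriou1994Parity, §5] -/
def Pigeon.IsValid (n : ℕ) : List (List (List Bool)) → Prop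
  | [C] => C.length = n
  | _ => False

/-- Solutions of PIGEONHOLE CIRCUIT, coded as pairs `⟨x, x'⟩` of vertices: `C(x) = 0ⁿ` (then `x'`
is immaterial), or `x ≠ x'` with `C(x) = C(x')`. [Papadimitriou 1994, §5 ("either find an input x
such that C(x) = 0ⁿ or two inputs x ≠ x' such that C(x) = C(x')")]
[cite: Papadimitriou1994Parity, §5] -/
def Pigeon.IsSolution (n : ℕ) : List (List (List Bool)) → List Bool → Prop
  | [C], y => ∃ x x' : List Bool, y = boolPair x x' ∧ x.length = n ∧ x'.length = n ∧
      (evalBits C x = zero n ∨ (x ≠ x' ∧ evalBits C x = evalBits C x'))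
  | _, _ => False

/-- **PIGEON** (PIGEONHOLE CIRCUIT). Given a circuit `C : {0,1}ⁿ → {0,1}ⁿ`, find `x` with
`C(x) = 0ⁿ` or `x ≠ x'` with `C(x) = C(x')`. The presenting (complete) problem of `PPP`.
[Papadimitriou 1994, §5 (pp. 528–529)] [cite: Papadimitriou1994Parity, §5] -/
def Pigeon : SearchProblem :=
  ofCircuits Pigeon.IsValid Pigeon.IsSolution

/-- PIGEON is polynomially balanced (`|⟨x, x'⟩| = 3n + 2`). [folklore] -/
theorem Pigeon.isPolyBalanced : Pigeon.IsPolyBalanced := by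
  refine ofCircuits_isPolyBalanced 3 fun n Cs y h => ?_
  match Cs, h with
  | [C], h =>
    simp only [Pigeon.IsSolution] at h
    obtain ⟨x, x', rfl, hx, hx', -⟩ := h
    rw [length_boolPair]
    omega

/-- **PIGEON is total** — the pigeonhole principle: if no vertex is mapped to `0ⁿ` then `C` maps the
`2ⁿ` vertices into `2ⁿ − 1` values, so two collide (`Fintype.exists_ne_map_eq_of_card_lt` on
`List.Vector Bool n`). [Papadimitriou 1994, §5 ("one of the two is guaranteed to exist by the
pigeonhole principle")] [cite: Papadimitriou1994Parity, §5] -/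
theorem Pigeon.isTotal : Pigeon.IsTotal := by
  classical
  refine ofCircuits_isTotal_iff.2 fun n Cs hV => ?_
  match Cs, hV with
  | [C], hV =>
    simp only [Pigeon.IsValid] at hV
    simp only [Pigeon.IsSolution]
    by_cases h0 : ∃ x : List Bool, x.length = n ∧ evalBits C x = zero n
    · obtain ⟨x, hx, hC⟩ := h0
      exact ⟨boolPair x x, x, x, rfl, hx, hx, Or.inl hC⟩
    · simp only [not_exists, not_and] at h0
      let z : List.Vector Bool n := ⟨zero n, length_zero n⟩
      let F : List.Vector Bool n → {v : List.Vector Bool n // v ≠ z} := fun x =>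
        ⟨⟨evalBits C x.1, by rw [length_evalBits, hV]⟩, fun h => h0 x.1 x.2 (congrArg Subtype.val h)⟩
      have hcard : Fintype.card {v : List.Vector Bool n // v ≠ z} < Fintype.card (List.Vector Bool n) :=
        Fintype.card_subtype_lt (x := z) (fun h => h rfl)
      obtain ⟨x, x', hne, hF⟩ := Fintype.exists_ne_map_eq_of_card_lt F hcard
      refine ⟨boolPair x.1 x'.1, x.1, x'.1, rfl, x.2, x'.2, Or.inr ⟨fun h => hne (Subtype.ext h), ?_⟩⟩
      exact congrArg (fun v : {v : List.Vector Bool n // v ≠ z} => v.1.1) hF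

end TFNP

/-! ### The classes `PPA` and `PPP` -/

/-- **`PPA`** ("polynomial parity argument"): the `TFNP` problems many-one reducible to LEAF, as
`TFNP.closureOf TFNP.Leaf`. [Papadimitriou 1994, §2 ("PPA is the closure under reductions of the
class of search problems defined so far")] [cite: Papadimitriou1994Parity, §2] -/
def PPA : Set SearchProblem :=
  TFNP.closureOf TFNP.Leaf

/-- **`PPP`** ("polynomial pigeonhole principle"): the `TFNP` problems many-one reducible to
PIGEONHOLE CIRCUIT, the complete problem of Papadimitriou's class, as
`TFNP.closureOf TFNP.Pigeon`. [Papadimitriou 1994, §5 (pp. 528–529)]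
[cite: Papadimitriou1994Parity, §5] -/
def PPP : Set SearchProblem :=
  TFNP.closureOf TFNP.Pigeon

/-- `PPA ⊆ TFNP`. [Papadimitriou 1994, §2] [cite: Papadimitriou1994Parity, §2] -/
theorem PPA_subset_TFNP : PPA ⊆ TFNP :=
  TFNP.closureOf_subset_TFNP _

/-- `PPP ⊆ TFNP` ("another subset of TFNP"). [Papadimitriou 1994, §5]
[cite: Papadimitriou1994Parity, §5] -/
theorem PPP_subset_TFNP : PPP ⊆ TFNP :=
  TFNP.closureOf_subset_TFNP _

/-- `PPA` is closed downwards under many-one reductions inside `TFNP`. [Papadimitriou 1994, §2]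
[cite: Papadimitriou1994Parity, §2] -/
theorem mem_PPA_of_manyOneReducible {R S : SearchProblem} (hR : R ∈ TFNP)
    (h : R.ManyOneReducible S) (hS : S ∈ PPA) : R ∈ PPA :=
  TFNP.mem_closureOf_of_manyOneReducible hR h hS

/-- `PPP` is closed downwards under many-one reductions inside `TFNP`. [Papadimitriou 1994, §5]
[cite: Papadimitriou1994Parity, §5] -/
theorem mem_PPP_of_manyOneReducible {R S : SearchProblem} (hR : R ∈ TFNP)
    (h : R.ManyOneReducible S) (hS : S ∈ PPP) : R ∈ PPP :=
  TFNP.mem_closureOf_of_manyOneReducible hR h hS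

/-- A `TFNP` problem that reduces to PIGEON is in `PPP` (the form in which "DIRICHLET `∈ PPP`" is
shown). [Papadimitriou 1994, §5] [cite: Papadimitriou1994Parity, §5] -/
theorem mem_PPP_of_manyOneReducible_pigeon {R : SearchProblem} (hR : R ∈ TFNP)
    (h : R.ManyOneReducible TFNP.Pigeon) : R ∈ PPP :=
  ⟨hR, h⟩

/-- A `TFNP` problem that reduces to LEAF is in `PPA`. [Papadimitriou 1994, §2]
[cite: Papadimitriou1994Parity, §2] -/
theorem mem_PPA_of_manyOneReducible_leaf {R : SearchProblem} (hR : R ∈ TFNP)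
    (h : R.ManyOneReducible TFNP.Leaf) : R ∈ PPA :=
  ⟨hR, h⟩

/-- Under `NP ⊆ P` every `PPP` problem is solvable in `FP` (so "`X ∈ PPP` is not solvable in
`FP`" refutes `P = NP`). [Megiddo–Papadimitriou 1991, p. 318 and Thm. 2.1]
[cite: MegiddoPapadimitriou1991, p. 318] -/
theorem solvableInFP_of_mem_PPP (hNP : Nondeterministic.NP ⊆ Classes.P) {R : SearchProblem}
    (hR : R ∈ PPP) : R.SolvableInFP :=
  SearchProblem.solvableInFP_of_mem_TFNP hNP (PPP_subset_TFNP hR)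

/-- Under `NP ⊆ P` every `PPA` problem is solvable in `FP`. [Megiddo–Papadimitriou 1991, p. 318
and Thm. 2.1] [cite: MegiddoPapadimitriou1991, p. 318] -/
theorem solvableInFP_of_mem_PPA (hNP : Nondeterministic.NP ⊆ Classes.P) {R : SearchProblem}
    (hR : R ∈ PPA) : R.SolvableInFP :=
  SearchProblem.solvableInFP_of_mem_TFNP hNP (PPA_subset_TFNP hR)

end Literature.Computability.Complexity
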